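import Literature.AlgebraicGeometry.Resolution.NodalBlowupStrictTransformPrimes
import Literature.AlgebraicGeometry.Resolution.BlowupAlgebraStrictTransform
import Literature.AlgebraicGeometry.Resolution.BlowupAlgebraPresentation
import Literature.AlgebraicGeometry.Resolution.BlowupAlgebraQuasiRegularChart
import HarnessLib

/-!
# The affine charts of the blow-up of `k⟦u, v, t⟧/(uv - t₁ ⋯ t_s)` in `(u, v, t_a, t_{a'})`: regularity and singular primes

Topic: `Literature/AlgebraicGeometry/Resolution`. Commutative algebra of the chart computation in
the proof of de Jong 1996, Claim 4.27 (p. 76), continued from `NodalBlowupChartAlgebra.lean` and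
`NodalBlowupStrictTransformPrimes.lean`, now for the charts of the blow-up of the HYPERSURFACE
`A = P/(F)`, `P = k⟦u, v, t₁, …, t_m⟧`, `F = uv - t₁ ⋯ t_s`, along `𝔭 = 𝔓 A`,
`𝔓 = (u, v, t_a, t_{a'})`:

> "We get four charts associated to the coordinates `u, v, t₁, t₂`. By symmetry, we need only
> deal with two of these. Chart "`u ≠ 0`". (…) equations `v = uv'`, `t₁ = ut₁'`, `t₂ = ut₂'` and
> `v' - t₁'t₂'t₃ ⋯ t_s = 0`. Clearly, this is smooth (…) Chart "`t₁ ≠ 0`". (…) equations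
> `u = t₁u'`, `v = t₁v'`, `t₂ = t₁t₂'` and `u'v' - t₂' t₃ ⋯ t_s = 0`. (…) The irreducible
> component `u' = v' = t₂' = t₃ = 0` of the singular locus maps onto `u = v = t₂ = t₃ = 0`, the
> component `u' = v' = t₃ = t₄ = 0` is the strict transform of the component `u = v = t₃ = t₄ = 0`."

PROVED:

* chart "`v ≠ 0`" (the symmetric of "`u ≠ 0`"): `strictTransformV = u' - t_a' t_{a'}' ∏''`,
  `F = v² F_v`, the derivation `v ∂/∂u` takes `F_v` to `1`, so `P[𝔓/v]/(F_v)` is regular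
  (`isRegularRing_quotient_strictTransformV`);
* the exceptional generator `b ∈ {u, v, t_a, t_{a'}}` is a prime element of `P[𝔓/b]`
  (`prime_algebraMap_centreSeq`, from `blowupAlgebra.isPrime_span_algebraMap`), and does not
  divide the strict transform `F_b` for `b = u, v, t_a` (`not_dvd_strictTransformU/V/T`: modulo
  `b`, in `(P/𝔓)[T_j]`, `F_b` is a non-zero polynomial);
* hence **the chart rings of the blow-up of `A` are `A[𝔭/b̄] ≅ P[𝔓/b]/(F_b)`**
  (`quotientStrictTransformUEquiv`, `…VEquiv`, `…TEquiv`, from `quotientKerMapQuotientEquiv` of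
  `BlowupAlgebraStrictTransform.lean`); the charts `u ≠ 0`, `v ≠ 0` are regular rings
  (`isRegularRing_aChartRing_inl_zero`, `…_inl_one`), and on the chart `t_a ≠ 0` **every prime
  `𝔮` of `A[𝔭/t̄_a]` with `A[𝔭/t̄_a]_𝔮` not regular contains a prime `𝔯 ∌ t̄_a` with
  `𝔭_{pq} A[𝔭/t̄_a] ⊆ 𝔯`** for a pair `p ≠ q` below `s` different from `a`
  (`exists_prime_le_of_not_isRegularLocalRing`: Stacks 07PF on `P[𝔓/t_a] ↠ A[𝔭/t̄_a]`, the
  Jacobian conclusion, and the primes of `NodalBlowupStrictTransformPrimes.lean` pushed forward) —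
  i.e. the non-regular points of the chart lie on the strict transforms of the `V(𝔭_{pq})`.
  Versions with the centre written as an arbitrary ideal equal to `𝔓` (`…_of_eq`) serve the
  chart `t_{a'} ≠ 0` by the symmetry `𝔓_{aa'} = 𝔓_{a'a}`.

## Sources

* A. J. de Jong, *Smoothness, semi-stability and alterations*, Publ. Math. IHÉS 83 (1996), 4.27,
  p. 76. [DeJong1996]
* The Stacks Project, Tag 07PF (via `PowerSeriesRegularLocal.lean`), Tag 0BIQ (via
  `BlowupAlgebraQuasiRegularChart.lean`). [StacksProject]
-/

noncomputable section

open IsLocalRing IsLocalization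

namespace Literature.AlgebraicGeometry.Resolution

universe u

namespace DeJong1996

variable (k : Type u) [Field k] (m s : ℕ) (a a' : Fin m)

local notation3 "𝙿" => MvPowerSeries (Fin 2 ⊕ Fin m) k

/-! ## Chart `v ≠ 0` -/

/-- The strict transform `F_v = u' - t_a' t_{a'}' ∏''` of `F` on the chart `v ≠ 0` (the chart
symmetric to "`u ≠ 0`": "`v' - t₁'t₂'t₃ ⋯ t_s`" with `u ↔ v`). [cite: DeJong1996, 4.27, p. 76] -/
def strictTransformV : ChartRing k m a a' (MvPowerSeries.X (Sum.inl 1)) :=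
  cgen _ (Sum.inl 0) (by simp [centreVars]) -
    cgen _ (Sum.inr a) (by simp [centreVars]) * cgen _ (Sum.inr a') (by simp [centreVars]) *
      algebraMap (MvPowerSeries (Fin 2 ⊕ Fin m) k) _ (restProd k m s a a')

/-- **`F = v² · F_v`** on the chart `v ≠ 0`. [cite: DeJong1996, 4.27, p. 76] -/
theorem algebraMap_nodalFamilyRelation_eq_V (haa' : a ≠ a') (ha : a.val < s) (ha' : a'.val < s) :
    algebraMap (MvPowerSeries (Fin 2 ⊕ Fin m) k) (ChartRing k m a a' (MvPowerSeries.X (Sum.inl 1)))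
        (nodalFamilyRelation k m s) =
      algebraMap (MvPowerSeries (Fin 2 ⊕ Fin m) k) _ (MvPowerSeries.X (Sum.inl 1)) ^ 2 *
        strictTransformV k m s a a' := by
  apply Subtype.ext
  simp only [Subalgebra.coe_algebraMap, Subalgebra.coe_pow, strictTransformV, Subalgebra.coe_mul,
    map_sub, map_mul, Subalgebra.coe_sub, blowupAlgebra.coe_gen, nodalFamilyRelation,
    prod_eq_mul_mul_restProd k m s a a' haa' ha ha']
  set L := Localization.Away (MvPowerSeries.X (Sum.inl 1) : MvPowerSeries (Fin 2 ⊕ Fin m) k)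
  have h := Away.mul_invSelf (S := L) (MvPowerSeries.X (Sum.inl 1) : MvPowerSeries (Fin 2 ⊕ Fin m) k)
  set V := algebraMap (MvPowerSeries (Fin 2 ⊕ Fin m) k) L (MvPowerSeries.X (Sum.inl 1))
  set ι := Away.invSelf (S := L) (MvPowerSeries.X (Sum.inl 1) : MvPowerSeries (Fin 2 ⊕ Fin m) k)
  linear_combination (algebraMap (MvPowerSeries (Fin 2 ⊕ Fin m) k) L (MvPowerSeries.X (Sum.inr a)) *
      algebraMap (MvPowerSeries (Fin 2 ⊕ Fin m) k) L (MvPowerSeries.X (Sum.inr a')) *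
      algebraMap (MvPowerSeries (Fin 2 ⊕ Fin m) k) L (restProd k m s a a') * (V * ι + 1) -
    V * algebraMap (MvPowerSeries (Fin 2 ⊕ Fin m) k) L (MvPowerSeries.X (Sum.inl 0))) * h

/-- **Chart `v ≠ 0`: the derivation `v ∂/∂u` takes `F_v` to `1`.** [cite: DeJong1996, 4.27, p. 76] -/
theorem exists_derivationV :
    ∃ D : Derivation k (ChartRing k m a a' (MvPowerSeries.X (Sum.inl 1)))
      (ChartRing k m a a' (MvPowerSeries.X (Sum.inl 1))), D (strictTransformV k m s a a') = 1 := by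
  classical
  obtain ⟨D, hD⟩ := exists_derivation_blowupAlgebra (I := nodalCentrePreimage k m a a')
    (a := (MvPowerSeries.X (Sum.inl 1) : MvPowerSeries (Fin 2 ⊕ Fin m) k)) k
    (MvPowerSeries.pderiv (Sum.inl 0))
  refine ⟨D, ?_⟩
  have hgen := fun (c : Fin 2 ⊕ Fin m) (hc : c ∈ centreVars m a a') =>
    Derivation.blowupAlgebra_apply_gen D hD (MvPowerSeries.X c) (X_mem_nodalCentrePreimage k hc)
  have hu : D (cgen _ (Sum.inl 0) (by simp [centreVars])) = 1 := by
    rw [hgen _ (by simp [centreVars])]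
    simp [MvPowerSeries.pderiv_X]
  have hta : D (cgen _ (Sum.inr a) (by simp [centreVars])) = 0 := by
    rw [hgen _ (by simp [centreVars])]
    simp [MvPowerSeries.pderiv_X]
  have hta' : D (cgen _ (Sum.inr a') (by simp [centreVars])) = 0 := by
    rw [hgen _ (by simp [centreVars])]
    simp [MvPowerSeries.pderiv_X]
  have hrest : D (algebraMap _ _ (restProd k m s a a')) = 0 := by
    rw [hD, pderiv_restProd_eq_zero (fun c _ => Sum.inr_ne_inl), map_zero, mul_zero]
  rw [strictTransformV, map_sub, hu, Derivation.leibniz, Derivation.leibniz, hta, hta', hrest]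
  simp

/-- **Chart `v ≠ 0` is smooth: `P[𝔓/v]/(F_v)` is a regular ring** (Stacks 07PF with the
derivation `v ∂/∂u`). [cite: DeJong1996, 4.27, p. 76] -/
theorem isRegularRing_quotient_strictTransformV (haa' : a ≠ a') :
    IsRegularRing (ChartRing k m a a' (MvPowerSeries.X (Sum.inl 1)) ⧸
      Ideal.span {strictTransformV k m s a a'}) := by
  obtain ⟨D, hD⟩ := exists_derivationV k m s a a'
  haveI : IsRegularRing (ChartRing k m a a' (MvPowerSeries.X (Sum.inl 1))) :=
    isRegularRing_chartRing k m a a' haa' 1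
  exact isRegularRing_quotient_of_derivation _ D (by rw [hD, map_one]; exact isUnit_one)

/-! ## The exceptional generator is prime and does not divide the strict transform -/

/-- The centre generators, by index (definitional unfolding of `centreSeq`). [folklore] -/
theorem centreSeq_zero : centreSeq k m a a' 0 = MvPowerSeries.X (Sum.inl 0) := rfl

/-- See `centreSeq_zero`. [folklore] -/
theorem centreSeq_one : centreSeq k m a a' 1 = MvPowerSeries.X (Sum.inl 1) := rfl

/-- See `centreSeq_zero`. [folklore] -/
theorem centreSeq_two : centreSeq k m a a' 2 = MvPowerSeries.X (Sum.inr a) := rfl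

/-- See `centreSeq_zero`. [folklore] -/
theorem centreSeq_three : centreSeq k m a a' 3 = MvPowerSeries.X (Sum.inr a') := rfl

/-- `P/𝔓` written with the centre sequence is a domain. [folklore] -/
instance isDomain_quotient_span_range_centreSeq :
    IsDomain (𝙿 ⧸ Ideal.span (Set.range (centreSeq k m a a'))) := by
  rw [span_range_centreSeq]
  haveI := isPrime_nodalCentrePreimage k m a a'
  infer_instance

/-- **The exceptional generator `b ∈ {u, v, t_a, t_{a'}}` is a prime element of `P[𝔓/b]`**
(`P[𝔓/b]/(b) ≅ (P/𝔓)[T_j : j ≠ i]`, a domain; Stacks 0BIQ). [cite: StacksProject, Tag 0BIQ] -/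
theorem prime_algebraMap_centreSeq (haa' : a ≠ a') (j : Fin 4) (b : 𝙿) (hb : centreSeq k m a a' j = b) :
    Prime (algebraMap 𝙿 (ChartRing k m a a' b) b) := by
  subst hb
  have hq := isQuasiRegular_centreSeq k m a a' haa'
  have h1 := blowupAlgebra.isPrime_span_algebraMap (centreSeq k m a a') j hq
  rw [span_range_centreSeq] at h1
  refine (Ideal.span_singleton_prime ?_).mp h1
  haveI : Nontrivial (ChartRing k m a a' (centreSeq k m a a' j)) := by
    change Nontrivial (ChartRing k m a a' (MvPowerSeries.X (centreIdx m a a' j)))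
    infer_instance
  exact nonZeroDivisors.ne_zero algebraMap_mem_nonZeroDivisors_blowupAlgebra

/-- **Evaluation of the chart ring modulo the exceptional generator at a point of `P/𝔓`.**
Through `P[𝔓/b]/(b) ≅ (P/𝔓)[T_j : j ≠ i]` (`blowupAlgebraQuotEquiv`, Stacks 0BIQ) and evaluation
of the `T_j` at `pt`: a ring map `Θ : P[𝔓/b] → P/𝔓` with `Θ(r) = r̄`, `Θ(x_j/b) = pt_j`, killing
the multiples of `b`. [cite: StacksProject, Tag 0BIQ] -/
theorem exists_chartEval (haa' : a ≠ a') (j : Fin 4) (b : 𝙿) (hb : centreSeq k m a a' j = b)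
    (pt : {j' : Fin 4 // j' ≠ j} → 𝙿 ⧸ nodalCentrePreimage k m a a') :
    ∃ Θ : ChartRing k m a a' b →+* 𝙿 ⧸ nodalCentrePreimage k m a a',
      (∀ r, Θ (algebraMap 𝙿 _ r) = Ideal.Quotient.mk _ r) ∧
      (∀ h0 : (0 : Fin 4) ≠ j, Θ (cgen b (Sum.inl 0) (inl_zero_mem_centreVars m a a')) = pt ⟨0, h0⟩) ∧
      (∀ h1 : (1 : Fin 4) ≠ j, Θ (cgen b (Sum.inl 1) (inl_one_mem_centreVars m a a')) = pt ⟨1, h1⟩) ∧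
      (∀ h2 : (2 : Fin 4) ≠ j, Θ (cgen b (Sum.inr a) (inr_left_mem_centreVars m a a')) = pt ⟨2, h2⟩) ∧
      (∀ h3 : (3 : Fin 4) ≠ j, Θ (cgen b (Sum.inr a') (inr_right_mem_centreVars m a a')) = pt ⟨3, h3⟩) ∧
      (∀ z, algebraMap 𝙿 _ b ∣ z → Θ z = 0) := by
  subst hb
  have hq := isQuasiRegular_centreSeq k m a a' haa'
  -- the statement for a centre ideal `I` given with proofs of membership of the generators, so that
  -- it can be specialised both to `span (range centreSeq)` (where `BlowupAlgebraPresentation.lean`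
  -- applies) and to `nodalCentrePreimage`
  have key : ∀ (I : Ideal 𝙿) (hI : Ideal.span (Set.range (centreSeq k m a a')) = I)
      (hmem : ∀ j', centreSeq k m a a' j' ∈ I),
      ∃ Θ : blowupAlgebra I (centreSeq k m a a' j) →+* 𝙿 ⧸ nodalCentrePreimage k m a a',
        (∀ r, Θ (algebraMap 𝙿 _ r) = Ideal.Quotient.mk _ r) ∧
        (∀ (j' : Fin 4) (hj' : j' ≠ j),
          Θ (blowupAlgebra.gen I (centreSeq k m a a' j) (centreSeq k m a a' j') (hmem j')) = pt ⟨j', hj'⟩) ∧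
        (∀ z, algebraMap 𝙿 _ (centreSeq k m a a' j) ∣ z → Θ z = 0) := by
    intro I hI hmem
    subst hI
    let QE := blowupAlgebraQuotEquiv (centreSeq k m a a') j hq
    let ι : (𝙿 ⧸ Ideal.span (Set.range (centreSeq k m a a'))) →+* 𝙿 ⧸ nodalCentrePreimage k m a a' :=
      (Ideal.quotEquivOfEq (span_range_centreSeq k m a a')).toRingHom
    have hι : ∀ r, ι (Ideal.Quotient.mk _ r) = Ideal.Quotient.mk _ r := fun r => rfl
    refine ⟨(MvPolynomial.eval₂Hom ι pt).comp (QE.symm.toRingHom.comp (Ideal.Quotient.mk _)),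
      fun r => ?_, fun j' hj' => ?_, fun z hz => ?_⟩
    · change MvPolynomial.eval₂Hom ι pt (QE.symm (Ideal.Quotient.mk _ (algebraMap 𝙿 _ r))) = _
      have : QE.symm (Ideal.Quotient.mk _ (algebraMap 𝙿 _ r)) = MvPolynomial.C (Ideal.Quotient.mk _ r) := by
        rw [RingEquiv.symm_apply_eq]
        exact (blowupAlgebraQuotEquiv_C (centreSeq k m a a') j hq r).symm
      rw [this, MvPolynomial.eval₂Hom_C, hι]
    · change MvPolynomial.eval₂Hom ι pt (QE.symm (Ideal.Quotient.mk _
        (blowupAlgebra.frac (centreSeq k m a a') j j'))) = _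
      have : QE.symm (Ideal.Quotient.mk _ (blowupAlgebra.frac (centreSeq k m a a') j j')) =
          MvPolynomial.X ⟨j', hj'⟩ := by
        rw [RingEquiv.symm_apply_eq]
        exact (blowupAlgebraQuotEquiv_X (centreSeq k m a a') j hq ⟨j', hj'⟩).symm
      rw [this, MvPolynomial.eval₂Hom_X']
    · change MvPolynomial.eval₂Hom ι pt (QE.symm (Ideal.Quotient.mk _ z)) = 0
      rw [Ideal.Quotient.eq_zero_iff_mem.mpr (Ideal.mem_span_singleton.mpr hz), map_zero, map_zero]
  have hmem : ∀ j', centreSeq k m a a' j' ∈ nodalCentrePreimage k m a a' := by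
    intro j'
    refine X_mem_nodalCentrePreimage k ?_
    have h := Set.mem_range_self (f := centreIdx m a a') j'
    rw [range_centreIdx] at h
    exact_mod_cast h
  obtain ⟨Θ, hC, hgen, hdvd⟩ := key (nodalCentrePreimage k m a a') (span_range_centreSeq k m a a') hmem
  exact ⟨Θ, hC, fun h0 => hgen 0 h0, fun h1 => hgen 1 h1, fun h2 => hgen 2 h2, fun h3 => hgen 3 h3, hdvd⟩

/-- **`u ∤ F_u`**: modulo `u`, `F_u = v' - t_a' t_{a'}' ∏''` becomes the polynomial
`V' - T_a T_{a'} ∏̄''` over `P/𝔓`, which takes the value `1` at `V' = 1, T_a = T_{a'} = 0`.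
[cite: DeJong1996, 4.27, p. 76] -/
theorem not_dvd_strictTransformU (haa' : a ≠ a') :
    ¬ algebraMap 𝙿 (ChartRing k m a a' (MvPowerSeries.X (Sum.inl 0))) (MvPowerSeries.X (Sum.inl 0)) ∣
      strictTransformU k m s a a' := by
  classical
  intro h
  obtain ⟨Θ, hC, -, h1, h2, h3, hdvd⟩ := exists_chartEval k m a a' haa' 0 _ (centreSeq_zero k m a a')
    (fun j' => if j'.1 = 1 then 1 else 0)
  haveI := isPrime_nodalCentrePreimage k m a a'
  have key := hdvd _ h
  rw [strictTransformU, map_sub, map_mul, map_mul, h1 (by decide), h2 (by decide), h3 (by decide),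
    hC] at key
  simp at key

/-- **`v ∤ F_v`** (symmetric to `not_dvd_strictTransformU`). [cite: DeJong1996, 4.27, p. 76] -/
theorem not_dvd_strictTransformV (haa' : a ≠ a') :
    ¬ algebraMap 𝙿 (ChartRing k m a a' (MvPowerSeries.X (Sum.inl 1))) (MvPowerSeries.X (Sum.inl 1)) ∣
      strictTransformV k m s a a' := by
  classical
  intro h
  obtain ⟨Θ, hC, h0, -, h2, h3, hdvd⟩ := exists_chartEval k m a a' haa' 1 _ (centreSeq_one k m a a')
    (fun j' => if j'.1 = 0 then 1 else 0)
  haveI := isPrime_nodalCentrePreimage k m a a'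
  have key := hdvd _ h
  rw [strictTransformV, map_sub, map_mul, map_mul, h0 (by decide), h2 (by decide), h3 (by decide),
    hC] at key
  simp at key

/-- `∏'' ∉ 𝔓`: none of its factors `t_c`, `c ∉ {a, a'}`, lies in the prime `𝔓`. [folklore] -/
theorem restProd_notMem_nodalCentrePreimage :
    restProd k m s a a' ∉ nodalCentrePreimage k m a a' := by
  classical
  haveI := isPrime_nodalCentrePreimage k m a a'
  rw [restProd]
  intro h
  obtain ⟨c, hc, hcmem⟩ := Ideal.IsPrime.prod_mem_iff.mp h
  obtain ⟨-, hca, hca'⟩ := mem_restIdx_iff.mp hc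
  exact X_inr_notMem_nodalCentrePreimage k hca hca' hcmem

/-- **`t_a ∤ F_t`**: modulo `t_a`, `F_t = u'v' - t_{a'}' ∏''` becomes `U'V' - T_{a'} ∏̄''` over
`P/𝔓`, which takes the value `-∏̄'' ≠ 0` at `U' = V' = 0, T_{a'} = 1` (`∏'' ∉ 𝔓`).
[cite: DeJong1996, 4.27, p. 76] -/
theorem not_dvd_strictTransformT (haa' : a ≠ a') :
    ¬ algebraMap 𝙿 (ChartRing k m a a' (MvPowerSeries.X (Sum.inr a))) (MvPowerSeries.X (Sum.inr a)) ∣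
      strictTransformT k m s a a' := by
  classical
  intro h
  obtain ⟨Θ, hC, h0, h1, -, h3, hdvd⟩ := exists_chartEval k m a a' haa' 2 _ (centreSeq_two k m a a')
    (fun j' => if j'.1 = 3 then 1 else 0)
  have key := hdvd _ h
  rw [strictTransformT, map_sub, map_mul, map_mul, h0 (by decide), h1 (by decide), h3 (by decide),
    hC] at key
  simp only [Fin.isValue, Fin.reduceEq, ↓reduceIte, mul_zero, one_mul, zero_sub, neg_eq_zero,
    Ideal.Quotient.eq_zero_iff_mem] at key
  exact restProd_notMem_nodalCentrePreimage k m s a a' key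

/-- The Jacobian criterion of `PowerSeriesRegularLocal.lean` (Stacks 07PF) read through a ring
isomorphism `C/(f) ≅ B`: if `B_𝔮` is not regular then every derivation of the regular ring `C`
takes `f` into the preimage of `𝔮` in `C`. [cite: StacksProject, Tag 07PF] -/
theorem _root_.Literature.AlgebraicGeometry.Resolution.Derivation.apply_mem_comap_comap_of_ringEquiv
    {C : Type u} [CommRing C] [IsRegularRing C] {S₀ : Type*} [CommSemiring S₀] [Algebra S₀ C]
    (D : Derivation S₀ C C) (f : C) {B : Type u} [CommRing B] (e : (C ⧸ Ideal.span {f}) ≃+* B)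
    (𝔮 : Ideal B) [𝔮.IsPrime] (h𝔮 : ¬ IsRegularLocalRing (Localization.AtPrime 𝔮)) :
    D f ∈ (𝔮.comap e).comap (Ideal.Quotient.mk (Ideal.span {f})) := by
  haveI : (𝔮.comap e).IsPrime := Ideal.comap_isPrime _ _
  refine Derivation.apply_mem_comap_of_not_isRegularLocalRing D f _ ?_
  intro hreg
  exact h𝔮 (IsRegularLocalRing.of_ringEquiv (IsLocalization.ringEquivOfRingEquiv
    (Localization.AtPrime (𝔮.comap e)) (Localization.AtPrime 𝔮) e
      (e.map_primeCompl_comap_eq 𝔮)))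

/-! ## The chart rings of the blow-up of `A = P/(F)` along `𝔭 = 𝔓 A` -/

/-- The chart ring `A[𝔭/b̄] ⊆ A[1/b̄]` of the blow-up of the hypersurface `A = P/(F)` along
`𝔭 = 𝔓 · A`, at the class `b̄` of `b ∈ P` (the target of `blowupAlgebra.mapQuotient`).
[cite: DeJong1996, 4.27, p. 76] -/
abbrev AChartRing (b : 𝙿) : Type u :=
  blowupAlgebra ((nodalCentrePreimage k m a a').map
    (Ideal.Quotient.mk (Ideal.span {nodalFamilyRelation k m s})))
    (Ideal.Quotient.mk (Ideal.span {nodalFamilyRelation k m s}) b)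

/-- **Chart `u ≠ 0` of the blow-up of `A`: `A[𝔭/ū] ≅ P[𝔓/u]/(F_u)`** ("equations `v = uv'`,
`t₁ = ut₁'`, `t₂ = ut₂'` and `v' - t₁'t₂'t₃ ⋯ t_s = 0`"). [cite: DeJong1996, 4.27, p. 76] -/
def quotientStrictTransformUEquiv (haa' : a ≠ a') (ha : a.val < s) (ha' : a'.val < s) :
    (ChartRing k m a a' (MvPowerSeries.X (Sum.inl 0)) ⧸ Ideal.span {strictTransformU k m s a a'}) ≃+*
      AChartRing k m s a a' (MvPowerSeries.X (Sum.inl 0)) :=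
  blowupAlgebra.quotientKerMapQuotientEquiv _ _ (algebraMap_nodalFamilyRelation_eq_U k m s a a' haa' ha ha')
    (prime_algebraMap_centreSeq k m a a' haa' 0 _ (centreSeq_zero k m a a')) (not_dvd_strictTransformU k m s a a' haa')

/-- **Chart `v ≠ 0` of the blow-up of `A`: `A[𝔭/v̄] ≅ P[𝔓/v]/(F_v)`.** [cite: DeJong1996, 4.27, p. 76] -/
def quotientStrictTransformVEquiv (haa' : a ≠ a') (ha : a.val < s) (ha' : a'.val < s) :
    (ChartRing k m a a' (MvPowerSeries.X (Sum.inl 1)) ⧸ Ideal.span {strictTransformV k m s a a'}) ≃+*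
      AChartRing k m s a a' (MvPowerSeries.X (Sum.inl 1)) :=
  blowupAlgebra.quotientKerMapQuotientEquiv _ _ (algebraMap_nodalFamilyRelation_eq_V k m s a a' haa' ha ha')
    (prime_algebraMap_centreSeq k m a a' haa' 1 _ (centreSeq_one k m a a')) (not_dvd_strictTransformV k m s a a' haa')

/-- **Chart `t_a ≠ 0` of the blow-up of `A`: `A[𝔭/t̄_a] ≅ P[𝔓/t_a]/(F_t)`** ("equations `u = t₁u'`,
`v = t₁v'`, `t₂ = t₁t₂'` and `u'v' - t₂' t₃ ⋯ t_s = 0`"). [cite: DeJong1996, 4.27, p. 76] -/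
def quotientStrictTransformTEquiv (haa' : a ≠ a') (ha : a.val < s) (ha' : a'.val < s) :
    (ChartRing k m a a' (MvPowerSeries.X (Sum.inr a)) ⧸ Ideal.span {strictTransformT k m s a a'}) ≃+*
      AChartRing k m s a a' (MvPowerSeries.X (Sum.inr a)) :=
  blowupAlgebra.quotientKerMapQuotientEquiv _ _ (algebraMap_nodalFamilyRelation_eq_T k m s a a' haa' ha ha')
    (prime_algebraMap_centreSeq k m a a' haa' 2 _ (centreSeq_two k m a a')) (not_dvd_strictTransformT k m s a a' haa')

/-- **The chart `u ≠ 0` of the blow-up of `A` is regular** ("Clearly, this is smooth").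
[cite: DeJong1996, 4.27, p. 76] -/
theorem isRegularRing_aChartRing_inl_zero (haa' : a ≠ a') (ha : a.val < s) (ha' : a'.val < s) :
    IsRegularRing (AChartRing k m s a a' (MvPowerSeries.X (Sum.inl 0))) :=
  haveI := isRegularRing_quotient_strictTransformU k m s a a' haa'
  IsRegularRing.of_ringEquiv (R := ChartRing k m a a' (MvPowerSeries.X (Sum.inl 0)) ⧸
    Ideal.span {strictTransformU k m s a a'}) (quotientStrictTransformUEquiv k m s a a' haa' ha ha')

/-- **The chart `v ≠ 0` of the blow-up of `A` is regular** (by symmetry).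
[cite: DeJong1996, 4.27, p. 76] -/
theorem isRegularRing_aChartRing_inl_one (haa' : a ≠ a') (ha : a.val < s) (ha' : a'.val < s) :
    IsRegularRing (AChartRing k m s a a' (MvPowerSeries.X (Sum.inl 1))) :=
  haveI := isRegularRing_quotient_strictTransformV k m s a a' haa'
  IsRegularRing.of_ringEquiv (R := ChartRing k m a a' (MvPowerSeries.X (Sum.inl 1)) ⧸
    Ideal.span {strictTransformV k m s a a'}) (quotientStrictTransformVEquiv k m s a a' haa' ha ha')

/-- The kernel of `P[𝔓/t_a] ↠ A[𝔭/t̄_a]` is `(F_t)`. [cite: DeJong1996, 4.27, p. 76] -/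
theorem ker_mapQuotient_T (haa' : a ≠ a') (ha : a.val < s) (ha' : a'.val < s) :
    RingHom.ker (blowupAlgebra.mapQuotient (nodalCentrePreimage k m a a')
      (MvPowerSeries.X (Sum.inr a) : 𝙿) (Ideal.span {nodalFamilyRelation k m s})) =
        Ideal.span {strictTransformT k m s a a'} :=
  blowupAlgebra.ker_mapQuotient_eq_span _ _ (algebraMap_nodalFamilyRelation_eq_T k m s a a' haa' ha ha')
    (prime_algebraMap_centreSeq k m a a' haa' 2 _ (centreSeq_two k m a a')) (not_dvd_strictTransformT k m s a a' haa')

/-- **Chart `t_a ≠ 0`: the non-regular points lie on the strict transforms of the `V(𝔭_{pq})`.**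
If `𝔮` is a prime of `A[𝔭/t̄_a]` at which `A[𝔭/t̄_a]` is not regular, then `𝔮` contains a prime
`𝔯 ∌ t̄_a` with `𝔭_{pq} · A[𝔭/t̄_a] ⊆ 𝔯` for some `p ≠ q` below `s`, both `≠ a` ("Clearly the
singularities are of the type described in (ii). The irreducible component `u' = v' = t₂' = t₃ = 0`
of the singular locus maps onto `u = v = t₂ = t₃ = 0`, the component `u' = v' = t₃ = t₄ = 0` is the
strict transform of the component `u = v = t₃ = t₄ = 0`"): pull `𝔮` back to `P[𝔓/t_a] ⊇ (F_t)`,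
apply the Jacobian criterion (Stacks 07PF, `Derivation.apply_mem_comap_of_not_isRegularLocalRing`)
and `exists_prime_le_of_forall_derivation_apply_mem`, and push the prime forward along
`P[𝔓/t_a] ↠ A[𝔭/t̄_a]`, whose kernel `(F_t)` it contains. [cite: DeJong1996, 4.27, p. 76] -/
theorem exists_prime_le_of_not_isRegularLocalRing (haa' : a ≠ a') (ha : a.val < s) (ha' : a'.val < s)
    (𝔮 : Ideal (AChartRing k m s a a' (MvPowerSeries.X (Sum.inr a)))) [𝔮.IsPrime]
    (h𝔮 : ¬ IsRegularLocalRing (Localization.AtPrime 𝔮)) :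
    ∃ p q : Fin m, p ≠ q ∧ p.val < s ∧ q.val < s ∧ p ≠ a ∧ q ≠ a ∧
      ∃ 𝔯 : Ideal (AChartRing k m s a a' (MvPowerSeries.X (Sum.inr a))), 𝔯.IsPrime ∧ 𝔯 ≤ 𝔮 ∧
        algebraMap (NodalFamilyRing k m s) _ (Ideal.Quotient.mk _ (MvPowerSeries.X (Sum.inr a))) ∉ 𝔯 ∧
          ((nodalCentrePreimage k m p q).map
            (Ideal.Quotient.mk (Ideal.span {nodalFamilyRelation k m s}))).map
              (algebraMap (NodalFamilyRing k m s) _) ≤ 𝔯 := by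
  -- notation
  let mq := blowupAlgebra.mapQuotient (nodalCentrePreimage k m a a')
    (MvPowerSeries.X (Sum.inr a) : 𝙿) (Ideal.span {nodalFamilyRelation k m s})
  have hmq : ∀ g, mq g = blowupAlgebra.mapQuotient (nodalCentrePreimage k m a a')
    (MvPowerSeries.X (Sum.inr a) : 𝙿) (Ideal.span {nodalFamilyRelation k m s}) g := fun g => rfl
  let e := quotientStrictTransformTEquiv k m s a a' haa' ha ha'
  have he : ∀ g : ChartRing k m a a' (MvPowerSeries.X (Sum.inr a) : 𝙿), e (Ideal.Quotient.mk _ g) = mq g :=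
    fun g => rfl
  have hker : RingHom.ker mq = Ideal.span {strictTransformT k m s a a'} :=
    ker_mapQuotient_T k m s a a' haa' ha ha'
  -- pull back `𝔮` to the regular ring `P[𝔓/t_a]` and apply the Jacobian criterion
  obtain ⟨Q, hQdef⟩ : ∃ Q : Ideal (ChartRing k m a a' (MvPowerSeries.X (Sum.inr a) : 𝙿)),
      Q = (𝔮.comap e).comap (Ideal.Quotient.mk (Ideal.span {strictTransformT k m s a a'})) :=
    ⟨_, rfl⟩
  have hQ : Q = 𝔮.comap mq := by
    rw [hQdef]
    ext x
    simp only [Ideal.mem_comap]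
    exact Iff.rfl
  haveI : Q.IsPrime := by rw [hQ]; exact Ideal.comap_isPrime _ _
  haveI : IsRegularRing (ChartRing k m a a' (MvPowerSeries.X (Sum.inr a) : 𝙿)) :=
    isRegularRing_chartRing k m a a' haa' 2
  have hval : ∀ D : Derivation k (ChartRing k m a a' (MvPowerSeries.X (Sum.inr a) : 𝙿))
      (ChartRing k m a a' (MvPowerSeries.X (Sum.inr a) : 𝙿)), D (strictTransformT k m s a a') ∈ Q :=
    fun D => hQdef ▸ Derivation.apply_mem_comap_comap_of_ringEquiv D _ e 𝔮 h𝔮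
  obtain ⟨p, q, hpq, hps, hqs, hpa, hqa, 𝔯, h𝔯, h𝔯Q, hta, hFt𝔯, hpq𝔯⟩ :=
    exists_prime_le_of_forall_derivation_apply_mem k m s a a' haa' ha' Q hval
  -- push forward along `mq`
  have hker𝔯 : RingHom.ker mq ≤ 𝔯 := by
    rw [hker, Ideal.span_le, Set.singleton_subset_iff]; exact hFt𝔯
  have hsurj : Function.Surjective mq := blowupAlgebra.mapQuotient_surjective _ _ _
  refine ⟨p, q, hpq, hps, hqs, hpa, hqa, 𝔯.map mq, Ideal.map_isPrime_of_surjective hsurj hker𝔯,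
    ?_, ?_, ?_⟩
  · rw [Ideal.map_le_iff_le_comap, ← hQ]; exact h𝔯Q
  · intro hmem
    apply hta
    have : algebraMap 𝙿 (ChartRing k m a a' (MvPowerSeries.X (Sum.inr a) : 𝙿))
        (MvPowerSeries.X (Sum.inr a)) ∈ (𝔯.map mq).comap mq := by
      rw [Ideal.mem_comap, hmq, blowupAlgebra.mapQuotient_algebraMap]
      exact hmem
    rwa [Ideal.comap_map_of_surjective _ hsurj, ← RingHom.ker_eq_comap_bot,
      sup_eq_left.mpr hker𝔯] at this
  · have hcomp : mq.comp (algebraMap 𝙿 (ChartRing k m a a' (MvPowerSeries.X (Sum.inr a) : 𝙿))) =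
        (algebraMap (NodalFamilyRing k m s)
        (AChartRing k m s a a' (MvPowerSeries.X (Sum.inr a)))).comp
          (Ideal.Quotient.mk (Ideal.span {nodalFamilyRelation k m s})) :=
      RingHom.ext fun r => blowupAlgebra.mapQuotient_algebraMap _ _ _ r
    rw [Ideal.map_map, ← hcomp, ← Ideal.map_map]
    exact Ideal.map_mono hpq𝔯

/-! ## The same with the centre an arbitrary ideal of `A` equal to `𝔭 = 𝔓 A` (for the symmetric charts) -/

/-- Chart `u ≠ 0` is regular, for a centre `I = 𝔓_{aa'} A` given up to equality. [cite: DeJong1996, 4.27, p. 76] -/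
theorem isRegularRing_chart_inl_zero_of_eq (haa' : a ≠ a') (ha : a.val < s) (ha' : a'.val < s)
    (I : Ideal (NodalFamilyRing k m s))
    (hI : I = (nodalCentrePreimage k m a a').map (Ideal.Quotient.mk (Ideal.span {nodalFamilyRelation k m s}))) :
    IsRegularRing (blowupAlgebra I
      (Ideal.Quotient.mk (Ideal.span {nodalFamilyRelation k m s}) (MvPowerSeries.X (Sum.inl 0)))) := by
  subst hI
  exact isRegularRing_aChartRing_inl_zero k m s a a' haa' ha ha'

/-- Chart `v ≠ 0` is regular, for a centre `I = 𝔓_{aa'} A` given up to equality. [cite: DeJong1996, 4.27, p. 76] -/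
theorem isRegularRing_chart_inl_one_of_eq (haa' : a ≠ a') (ha : a.val < s) (ha' : a'.val < s)
    (I : Ideal (NodalFamilyRing k m s))
    (hI : I = (nodalCentrePreimage k m a a').map (Ideal.Quotient.mk (Ideal.span {nodalFamilyRelation k m s}))) :
    IsRegularRing (blowupAlgebra I
      (Ideal.Quotient.mk (Ideal.span {nodalFamilyRelation k m s}) (MvPowerSeries.X (Sum.inl 1)))) := by
  subst hI
  exact isRegularRing_aChartRing_inl_one k m s a a' haa' ha ha'

/-- Chart `t_a ≠ 0`: singular primes contain strict-transform primes, for a centre `I = 𝔓_{aa'} A`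
given up to equality (apply with `(a, a')` or `(a', a)`: `𝔓_{aa'} = 𝔓_{a'a}`).
[cite: DeJong1996, 4.27, p. 76] -/
theorem exists_prime_le_of_not_isRegularLocalRing_of_eq (haa' : a ≠ a') (ha : a.val < s)
    (ha' : a'.val < s) (I : Ideal (NodalFamilyRing k m s))
    (hI : I = (nodalCentrePreimage k m a a').map (Ideal.Quotient.mk (Ideal.span {nodalFamilyRelation k m s})))
    (𝔮 : Ideal (blowupAlgebra I
      (Ideal.Quotient.mk (Ideal.span {nodalFamilyRelation k m s}) (MvPowerSeries.X (Sum.inr a)))))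
    [𝔮.IsPrime] (h𝔮 : ¬ IsRegularLocalRing (Localization.AtPrime 𝔮)) :
    ∃ p q : Fin m, p ≠ q ∧ p.val < s ∧ q.val < s ∧ p ≠ a ∧ q ≠ a ∧
      ∃ 𝔯 : Ideal (blowupAlgebra I
        (Ideal.Quotient.mk (Ideal.span {nodalFamilyRelation k m s}) (MvPowerSeries.X (Sum.inr a)))),
        𝔯.IsPrime ∧ 𝔯 ≤ 𝔮 ∧
          algebraMap (NodalFamilyRing k m s) _ (Ideal.Quotient.mk _ (MvPowerSeries.X (Sum.inr a))) ∉ 𝔯 ∧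
            ((nodalCentrePreimage k m p q).map
              (Ideal.Quotient.mk (Ideal.span {nodalFamilyRelation k m s}))).map
                (algebraMap (NodalFamilyRing k m s) _) ≤ 𝔯 := by
  subst hI
  exact exists_prime_le_of_not_isRegularLocalRing k m s a a' haa' ha ha' 𝔮 h𝔮

/-- `𝔓_{aa'} = 𝔓_{a'a}`. [folklore] -/
theorem nodalCentrePreimage_comm : nodalCentrePreimage k m a a' = nodalCentrePreimage k m a' a := by
  unfold nodalCentrePreimage
  congr 2
  ext c
  simp only [centreVars, Finset.coe_insert, Finset.coe_singleton, Set.mem_insert_iff,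
    Set.mem_singleton_iff]
  tauto

end DeJong1996

end Literature.AlgebraicGeometry.Resolution

end
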